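import Summits.CriticalPhenomena.PercolationContinuityZ3.Theorems.PercNearOneGluingNoHeavyPcintChordMemZ6B10Defs
import HarnessLib

/-!
# PCINT lane, kernel reduced-state B3r certificate `Z6B10` (bond, d = 6, memory τ = 10, 6192 state classes): row checks 9 (rows [4800, 5400))

Cell `prim-pcint`, seat `prim-pcint-2` (gen 4); memo `run/shared/lean/prim/pcint/REDUCTIONS.md` §B3r and HANDOFF ("B3r on reduced states").
Does NOT build on p205010.  Data for `BondK.le_criticalProb_of_checkRowsB` (`…PcintChordMemKernelCert`): `p = 9290/100000`,
`s̄ = 99568/100000` (`s̄²+p² ≥ 1`), refund `r = 100434/100000` (`s̄·r ≥ 1`, `(1-p)·r ≤ 1`), `κ̄ = (100000+99568)/(2·100000)`, `λ = 99999/100000`;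
Collatz–Wielandt weights (scale 10⁹) from a power iteration (ρ ≈ 0.9997074), exact off-line max row ratio 0.9997073741 < λ.
Generated by work/gen/gen_b3r_kernel.py (prim-pcint-2 gen 4 folder; copy in run/shared/lean/prim/pcint/prim-pcint-2/kernel/); the kernel re-checks every row.
-/

namespace Summit.CriticalPhenomena.PercolationContinuityZ3.Theorems.Pcint.ChordMemZ6B10

set_option maxHeartbeats 0 in
/-- Rows `[4800, 4900)` pass the check. [folklore] -/
theorem chk_4800 : WinK.allRange (BondK.checkRowB 10 6 6192 9290 100434 99568 100000 99999 100000 ChordMemZ6B10.syms ChordMemZ6B10.tree) 4800 4900 = true :=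
  WinK.allRange_of_allRangeB (fuel := 8) (lo := 4800) (len := 100) (by decide +kernel)

set_option maxHeartbeats 0 in
/-- Rows `[4900, 5000)` pass the check. [folklore] -/
theorem chk_4900 : WinK.allRange (BondK.checkRowB 10 6 6192 9290 100434 99568 100000 99999 100000 ChordMemZ6B10.syms ChordMemZ6B10.tree) 4900 5000 = true :=
  WinK.allRange_of_allRangeB (fuel := 8) (lo := 4900) (len := 100) (by decide +kernel)

set_option maxHeartbeats 0 in
/-- Rows `[5000, 5100)` pass the check. [folklore] -/
theorem chk_5000 : WinK.allRange (BondK.checkRowB 10 6 6192 9290 100434 99568 100000 99999 100000 ChordMemZ6B10.syms ChordMemZ6B10.tree) 5000 5100 = true :=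
  WinK.allRange_of_allRangeB (fuel := 8) (lo := 5000) (len := 100) (by decide +kernel)

set_option maxHeartbeats 0 in
/-- Rows `[5100, 5200)` pass the check. [folklore] -/
theorem chk_5100 : WinK.allRange (BondK.checkRowB 10 6 6192 9290 100434 99568 100000 99999 100000 ChordMemZ6B10.syms ChordMemZ6B10.tree) 5100 5200 = true :=
  WinK.allRange_of_allRangeB (fuel := 8) (lo := 5100) (len := 100) (by decide +kernel)

set_option maxHeartbeats 0 in
/-- Rows `[5200, 5300)` pass the check. [folklore] -/
theorem chk_5200 : WinK.allRange (BondK.checkRowB 10 6 6192 9290 100434 99568 100000 99999 100000 ChordMemZ6B10.syms ChordMemZ6B10.tree) 5200 5300 = true :=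
  WinK.allRange_of_allRangeB (fuel := 8) (lo := 5200) (len := 100) (by decide +kernel)

set_option maxHeartbeats 0 in
/-- Rows `[5300, 5400)` pass the check. [folklore] -/
theorem chk_5300 : WinK.allRange (BondK.checkRowB 10 6 6192 9290 100434 99568 100000 99999 100000 ChordMemZ6B10.syms ChordMemZ6B10.tree) 5300 5400 = true :=
  WinK.allRange_of_allRangeB (fuel := 8) (lo := 5300) (len := 100) (by decide +kernel)

/-- Rows `[4800, 5400)` pass the check. [folklore] -/
theorem file_9 : WinK.allRange (BondK.checkRowB 10 6 6192 9290 100434 99568 100000 99999 100000 ChordMemZ6B10.syms ChordMemZ6B10.tree) 4800 5400 = true := (WinK.allRange_split (WinK.allRange_split (WinK.allRange_split (WinK.allRange_split (WinK.allRange_split chk_4800 chk_4900) chk_5000) chk_5100) chk_5200) chk_5300)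

end Summit.CriticalPhenomena.PercolationContinuityZ3.Theorems.Pcint.ChordMemZ6B10
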